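import Mathlib
import Summits.Ventures.PercRepro2.Defs
import Summits.Ventures.PercRepro2.Harris
import Summits.Ventures.PercRepro2.Graph
import Summits.Ventures.PercRepro2.Events
import Summits.Ventures.PercRepro2.TReduction

/-!
# The antipodal base cases are 2-colouring sums; (T_h) for cluster events from them
(blind cell PercRepro2, mine-a g41)

A `0/1` weight vector `q` puts all its mass on one configuration `detConfig q` (`prob_of_zero_one`),
so at a base case of `TReduction` — weights `a` that are `0/1`-valued off `D` — the antipodal sum is
(`kform_eq_antipodal_sum`)

  `K_D(a) = Σ_{σ supported on D} 1_Q(c_σ) (1_U(c_σ) − 1_U(c_σ̄)) (1_e(c_σ) − 1_e(c_σ̄))`,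

`c_σ = baseConfig a D σ` the configuration with state `σ` on `D` and the pinned states elsewhere,
`c_σ̄` its antipode on `D`: a sum over the 2-colourings (red = open in `c_σ`, blue = open in
`c_σ̄`) of the edges of `D`, the other edges contracted or deleted.  With the cell's cluster events
`Q = {h ∈ C_s}`, `U = {C_s ∈ 𝓤}`, `e = {C_s ∈ 𝓥}` this is the uniform 2-colouring inequality
(K₀⁰) of MINE-A.md §96 on every minor of the graph, and `t_cluster_of_antipodal_base` states the
consequence: (T_h) for every admissible weight vector.  No instance, no notation.
-/

namespace Summit.Ventures.PercRepro2

namespace TReduction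

open Finset

section BaseCase

variable {E : Type*} [Fintype E] [DecidableEq E] {R : Type*} [Field R] [DecidableEq R]

/-- The configuration carried by a `0/1` weight vector: open exactly at the edges of weight `1`. -/
def detConfig (q : E → R) : Config E := fun x => decide (q x = 1)

omit [Fintype E] [DecidableEq E] in
/-- At a `0/1` weight, the edge factor is the indicator of agreement with `decide (q = 1)`. -/
lemma edgeFactor_of_zero_one {q : R} (hq : q = 0 ∨ q = 1) (b : Bool) :
    edgeFactor q b = if b = decide (q = 1) then 1 else 0 := by
  rcases hq with rfl | rfl
  · cases b <;> simp [edgeFactor]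
  · cases b <;> simp [edgeFactor]

omit [DecidableEq E] in
/-- A `0/1` weight vector puts all its mass on `detConfig`. -/
lemma weight_of_zero_one {q : E → R} (hq : ∀ x, q x = 0 ∨ q x = 1) (ω : Config E) :
    weight q ω = if ω = detConfig q then 1 else 0 := by
  unfold weight
  by_cases h : ω = detConfig q
  · subst h
    rw [if_pos rfl]
    refine prod_eq_one fun x _ => ?_
    rw [edgeFactor_of_zero_one (hq x)]
    simp [detConfig]
  · rw [if_neg h]
    obtain ⟨x, hx⟩ : ∃ x, ω x ≠ detConfig q x := by
      by_contra hcon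
      exact h (funext fun x => by_contra fun hne => hcon ⟨x, hne⟩)
    refine prod_eq_zero (mem_univ x) ?_
    rw [edgeFactor_of_zero_one (hq x)]
    simp only [detConfig] at hx
    simp [hx]

/-- The probability of an event under a `0/1` weight vector is the indicator of `detConfig`. -/
lemma prob_of_zero_one {q : E → R} (hq : ∀ x, q x = 0 ∨ q x = 1) (A : Set (Config E)) :
    prob q A = A.indicator (fun _ => (1 : R)) (detConfig q) := by
  classical
  unfold prob
  rw [Finset.sum_eq_single (detConfig q)]
  · by_cases hA : detConfig q ∈ A
    · simp [Set.indicator_of_mem hA, weight_of_zero_one hq]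
    · simp [Set.indicator_of_notMem hA]
  · intro ω _ hω
    by_cases hA : ω ∈ A
    · simp [Set.indicator_of_mem hA, weight_of_zero_one hq, hω]
    · simp [Set.indicator_of_notMem hA]
  · intro h
    exact absurd (mem_univ _) h

/-- The configuration of the pinned weights `a[σ on D]`: `σ` on `D`, the pinned state elsewhere. -/
def baseConfig (a : E → R) (D : Finset E) (σ : Config E) : Config E :=
  fun x => if x ∈ D then σ x else decide (a x = 1)

omit [Fintype E] [DecidableEq R] in
/-- The pinned weights are `0/1`-valued when `a` is `0/1`-valued off `D`. -/
lemma pinD_zero_one {a : E → R} {D : Finset E} (ha : ∀ x, x ∉ D → a x = 0 ∨ a x = 1)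
    (σ : Config E) (x : E) : pinD a D σ x = 0 ∨ pinD a D σ x = 1 := by
  by_cases hx : x ∈ D
  · rw [pinD_of_mem a σ hx]
    cases σ x <;> simp
  · rw [pinD_of_not_mem a σ hx]
    exact ha x hx

omit [Fintype E] in
/-- `detConfig` of the pinned weights is `baseConfig`. -/
lemma detConfig_pinD (a : E → R) (D : Finset E) (σ : Config E) :
    detConfig (pinD a D σ) = baseConfig a D σ := by
  funext x
  by_cases hx : x ∈ D
  · simp only [detConfig, baseConfig, pinD_of_mem a σ hx, hx, if_true]
    cases σ x <;> simp
  · simp [detConfig, baseConfig, pinD_of_not_mem a σ hx, hx]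

/-- **The base case is the combinatorial antipodal sum**: for `a` `0/1`-valued off `D`,
`K_D(a) = Σ_{σ supported on D} 1_Q(c_σ) (1_U(c_σ) − 1_U(c_σ̄)) (1_e(c_σ) − 1_e(c_σ̄))`, with
`c_σ = baseConfig a D σ` and `c_σ̄ = baseConfig a D (!σ)` its antipode on `D`. -/
theorem kform_eq_antipodal_sum (Q U e : Set (Config E)) {D : Finset E} {a : E → R}
    (ha : ∀ x, x ∉ D → a x = 0 ∨ a x = 1) :
    kform Q U e D a =
      ∑ σ ∈ suppOn D,
        Q.indicator (fun _ => (1 : R)) (baseConfig a D σ)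
          * (U.indicator (fun _ => (1 : R)) (baseConfig a D σ)
              - U.indicator (fun _ => (1 : R)) (baseConfig a D fun x => !σ x))
          * (e.indicator (fun _ => (1 : R)) (baseConfig a D σ)
              - e.indicator (fun _ => (1 : R)) (baseConfig a D fun x => !σ x)) := by
  unfold kform gform
  refine sum_congr rfl fun σ _ => ?_
  rw [prob_of_zero_one (pinD_zero_one ha σ), prob_of_zero_one (pinD_zero_one ha σ),
    prob_of_zero_one (pinD_zero_one ha σ), prob_of_zero_one (pinD_zero_one ha σ),
    prob_of_zero_one (pinD_zero_one ha _), prob_of_zero_one (pinD_zero_one ha _),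
    prob_of_zero_one (pinD_zero_one ha _), detConfig_pinD, detConfig_pinD]
  by_cases hQ : baseConfig a D σ ∈ Q <;> by_cases hU : baseConfig a D σ ∈ U <;>
    by_cases he : baseConfig a D σ ∈ e <;>
    by_cases hU' : baseConfig a D (fun x => !σ x) ∈ U <;>
    by_cases he' : baseConfig a D (fun x => !σ x) ∈ e <;>
    simp [hQ, hU, he, hU', he']

end BaseCase

section Cluster

variable {V : Type*} {E : Type*} [Fintype E] [DecidableEq E] {R : Type*} [Field R] [LinearOrder R]
  [IsStrictOrderedRing R]

/-- **(T_h) for cluster events from the antipodal base cases**: for admissible weights, a root `s`,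
a vertex `h` and families `𝓤 𝓥` of vertex sets, if every antipodal base case of the three events
`Q = {h ∈ C_s}`, `U = {C_s ∈ 𝓤}`, `e = {C_s ∈ 𝓥}` is nonnegative (the uniform 2-colouring
inequality on every minor), then (T_h) holds in the form of `TFKG.t_of_isForest`. -/
theorem t_cluster_of_antipodal_base (p : E → R) (hp : IsProbVec p) (ends : E → Sym2 V) (s h : V)
    (𝓤 𝓥 : Set (Set V))
    (hbase : ∀ (D : Finset E) (a : E → R), IsProbVec a → (∀ x, x ∉ D → a x = 0 ∨ a x = 1) →
      0 ≤ kform (clusterInEvent ends s {T : Set V | h ∈ T}) (clusterInEvent ends s 𝓤)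
        (clusterInEvent ends s 𝓥) D a) :
    let Q := clusterInEvent ends s {T : Set V | h ∈ T}
    let U := clusterInEvent ends s 𝓤
    let e := clusterInEvent ends s 𝓥
    prob p (Q ∩ U) * prob p e + prob p U * prob p (Q ∩ e) ≤
      prob p (Q ∩ U ∩ e) + prob p Q * prob p (U ∩ e) := by
  intro Q U e
  have h := tform_nonneg_of_base Q U e hbase p hp
  linarith [mul_comm (prob p U) (prob p (Q ∩ e))]

end Cluster

end TReduction

end Summit.Ventures.PercRepro2
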